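import Mathlib
import HarnessLib
import Literature.MathematicalPhysics.QuantumFieldTheory.YangMillsOS
import Literature.MathematicalPhysics.QuantumFieldTheory.SpeciesTimeReflection
import Literature.MathematicalPhysics.QuantumFieldTheory.WilsonAxisSymmetry
import Summits.QuantumFields.YangMills.Theorems.ParabolicTrajectoryLatticeGapOnTrajectoryStubNegReflectRP
import Summits.QuantumFields.YangMills.Theorems.FradkinShenkerFlowFiniteSusceptibilityWeakCouplingRPCauchySchwarz
import Summits.QuantumFields.YangMills.Theorems.PencilRigidityCurvatureKernelBoundLatticeWindowPairOfOne

/-!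
# `CurvatureKernelBound` (stmt-QuantumFields-11687), line `sixteen-charts-analytic-kernel`, skeleton v13 — stub `AxisDominationOfForm`

Helper file of the lead (prover-line-stmt-QuantumFields-11687-c4-0) for the registered stub A of skeleton v13.
-/

noncomputable section

open scoped BigOperators Topology ComplexConjugate
open Filter Set Function TopologicalSpace MeasureTheory
open Literature.MathematicalPhysics.QuantumLattice Literature.MathematicalPhysics.AQFT Literature.MathematicalPhysics.QuantumFieldTheory

namespace Summit.QuantumFields.YangMills.Theorems.CurvatureKernel


/-!
## Stub A · `AxisDominationOfForm` — THE TIME AXIS IS EXTREMAL (lead c4)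

From the odd-torus site-reflection-positivity form F (`OddTorusCovCauchySchwarz`, landed p127937) we derive, for `β ≥ 0`, a
separation `z` with time component `z 0 = n`, `3 ≤ n ≤ L`, on the torus `(ℤ/(2L+1))⁴`:
`Cov(Q_0, Q_z)² ≤ lCC(Q, Q^θ, 2⌈n/2⌉) · lCC(Q^θ, Q, 2⌊n/2⌋)`, both axis factors `≥ 0`, where `Q = r.curvature.F` is Wilson's corner
action density, `Q^θ = r.curvature.timeReflect.F` its site-time-reflected variant and `lCC = latticeConnectedCorr` (the axis
time-correlation of `HasLatticeMassGap`). Proof: apply F to `F₀ = Q^θ` translated to `t' e₀` and `G₀ = Q` translated to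
`v = z − t' e₀` (`t' = ⌈n/2⌉`, `v 0 = t = ⌊n/2⌋`; both live in the closed positive half of `Θ'`), use the reflection identities
`(Q_x ∘ lift) ∘ Θ' = Q^θ_{θ₀x} ∘ lift`, `(Q^θ_x ∘ lift) ∘ Θ' = Q_{θ₀x} ∘ lift` (tree `torusLift_negReflect`, `cfgReflect_configShift`)
and torus translation invariance in lifted form (tree `integral_comp_configShift_torusLift`). [OsterwalderSeiler1978 §2; folklore]
-/

namespace AxisDom

open Literature.Probability.LatticeModels (Site Torus.proj_apply)

variable {G : Type} [Group G] [TopologicalSpace G] [IsTopologicalGroup G] [CompactSpace G] [MeasurableSpace G] [BorelSpace G]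

/-! ### Geometry of the corner support and of the site reflection -/

/-- Base times of the declared support of the curvature species lie in `{0, 1}`. [folklore] -/
theorem curvature_supp_time (r : LatticeRep G) {e : Literature.MathematicalPhysics.QuantumLattice.ZdEdge 4}
    (he : e ∈ r.curvature.supp) : e.1 0 = 0 ∨ e.1 0 = 1 := by
  have hs : r.curvature.supp = Finset.univ.biUnion fun p : Fin 4 × Fin 4 => originPlaquetteSupport p.1 p.2 := rfl
  rw [hs, Finset.mem_biUnion] at he
  obtain ⟨p, -, hp⟩ := he
  simp only [originPlaquetteSupport, Finset.mem_insert, Finset.mem_singleton] at hp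
  rcases hp with rfl | rfl | rfl | rfl
  · exact Or.inl rfl
  · by_cases h : p.1 = 0
    · exact Or.inr (by simp [h])
    · exact Or.inl (by simp [h])
  · by_cases h : p.2 = 0
    · exact Or.inr (by simp [h])
    · exact Or.inl (by simp [h])
  · exact Or.inl rfl

/-- `x − θ₀ x = 2 x⁰ e₀`. [folklore] -/
theorem sub_siteReflect_eq_single (x : Site 4) : x - siteReflect x = Pi.single 0 (2 * x 0) := by
  funext k
  rw [Pi.sub_apply, siteReflect_apply_ite]
  by_cases hk : k = 0
  · subst hk; simp; ring
  · simp [hk]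

/-- `val` of a small non-negative integer cast into `ZMod T`. [folklore] -/
theorem val_intCast_of_nonneg_of_lt {T : ℕ} [NeZero T] {a : ℤ} (h0 : 0 ≤ a) (hT : a < T) :
    (((a : ZMod T)).val : ℤ) = a := by
  rw [ZMod.val_intCast, Int.emod_eq_of_lt h0 hT]

/-! ### The lifted, translated observables: dependence on the positive half -/

omit [TopologicalSpace G] [IsTopologicalGroup G] [CompactSpace G] [BorelSpace G] in
/-- A translated cylinder observable read through the periodic lift depends only on the torus edges below its translated
support. [folklore] -/
theorem dependsOn_shift_lift (s : LocalGaugeObservable 4 G) (T : ℕ) (x : Site 4) :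
    DependsOn (fun U : GaugeConfig 4 T G => s.F (configShift (-x) (torusLift T U)))
      {e' | e' ∈ s.supp.image fun e => torusEdge T (e.1 + x, e.2)} := by
  intro U V hUV
  refine s.isCylinder fun e he => ?_
  rw [configShift_apply, configShift_apply, sub_neg_eq_add]
  exact hUV _ (by
    rw [Set.mem_setOf_eq]
    exact Finset.mem_image_of_mem _ (Finset.mem_coe.1 he))

/-- The corner density translated to a base point of time `t` with `t + 2 ≤ S` is an observable of the closed positive half
of `Θ'` on the torus `2S+1`. [folklore] -/
theorem dependsOn_curv_posHalf (r : LatticeRep G) {S : ℕ} (x : Site 4) {t : ℕ} (hx : x 0 = t) (ht : t + 2 ≤ S) :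
    DependsOn (fun U : GaugeConfig 4 (2 * S + 1) G => r.curvature.F (configShift (-x) (torusLift (2 * S + 1) U)))
      {e : Edge 4 (2 * S + 1) | (e.1 0).val ≤ S ∧ (e.2 = 0 → (e.1 0).val < S)} := by
  refine (dependsOn_shift_lift r.curvature (2 * S + 1) x).mono ?_
  intro e' he'
  simp only [Set.mem_setOf_eq, Finset.mem_image] at he'
  obtain ⟨e, he, rfl⟩ := he'
  have key : ∀ a : ℤ, 0 ≤ a → a + 1 ≤ S →
      ((a : ZMod (2 * S + 1))).val ≤ S ∧ ((a : ZMod (2 * S + 1))).val < S := by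
    intro a h0 h2
    have hv := val_intCast_of_nonneg_of_lt (T := 2 * S + 1) h0 (by push_cast; omega)
    constructor <;> omega
  simp only [Set.mem_setOf_eq, torusEdge, Torus.proj_apply, Pi.add_apply, hx]
  rcases curvature_supp_time r he with h0 | h1
  · rw [h0, zero_add]
    obtain ⟨h1, h2⟩ := key t (by omega) (by omega)
    exact ⟨h1, fun _ => h2⟩
  · rw [h1]
    obtain ⟨h1, h2⟩ := key (1 + t) (by omega) (by omega)
    exact ⟨h1, fun _ => h2⟩

/-- The time-reflected corner density translated to a base point of time `t'` with `2 ≤ t' ≤ S` is an observable of the closed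
positive half of `Θ'` on the torus `2S+1`. [folklore] -/
theorem dependsOn_curvθ_posHalf (r : LatticeRep G) {S : ℕ} (x : Site 4) {t' : ℕ} (hx : x 0 = t') (h2 : 2 ≤ t') (hS : t' ≤ S) :
    DependsOn (fun U : GaugeConfig 4 (2 * S + 1) G => r.curvature.timeReflect.F (configShift (-x) (torusLift (2 * S + 1) U)))
      {e : Edge 4 (2 * S + 1) | (e.1 0).val ≤ S ∧ (e.2 = 0 → (e.1 0).val < S)} := by
  refine (dependsOn_shift_lift r.curvature.timeReflect (2 * S + 1) x).mono ?_
  intro e' he'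
  simp only [Set.mem_setOf_eq, LocalGaugeObservable.timeReflect_supp, Finset.mem_image] at he'
  obtain ⟨e'', ⟨e, he, rfl⟩, rfl⟩ := he'
  have key : ∀ a : ℤ, 0 ≤ a → a ≤ S → ((a : ZMod (2 * S + 1))).val ≤ S := by
    intro a h0 h2
    have hv := val_intCast_of_nonneg_of_lt (T := 2 * S + 1) h0 (by push_cast; omega)
    omega
  have key' : ∀ a : ℤ, 0 ≤ a → a < S → ((a : ZMod (2 * S + 1))).val < S := by
    intro a h0 h2
    have hv := val_intCast_of_nonneg_of_lt (T := 2 * S + 1) h0 (by push_cast; omega)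
    omega
  have htime := curvature_supp_time r he
  by_cases h2e : e.2 = 0
  · -- temporal link: reflected base time `−e⁰ − 1`, read at `−e⁰ − 1 + t'`
    simp only [Set.mem_setOf_eq, torusEdge, Torus.proj_apply, reflectEdge, h2e, ↓reduceIte, Pi.add_apply, Pi.sub_apply,
      siteReflect_apply_zero, hx, Pi.single_eq_same]
    rcases htime with h0 | h1
    · rw [h0]
      exact ⟨key _ (by omega) (by omega), fun _ => key' _ (by omega) (by omega)⟩
    · rw [h1]
      exact ⟨key _ (by omega) (by omega), fun _ => key' _ (by omega) (by omega)⟩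
  · -- spatial link: reflected base time `−e⁰`, read at `−e⁰ + t'`
    simp only [Set.mem_setOf_eq, torusEdge, Torus.proj_apply, reflectEdge, h2e, ↓reduceIte, Pi.add_apply,
      siteReflect_apply_zero, hx]
    rcases htime with h0 | h1
    · rw [h0]
      exact ⟨key _ (by omega) (by omega), fun h => h.elim⟩
    · rw [h1]
      exact ⟨key _ (by omega) (by omega), fun h => h.elim⟩

/-! ### Reflection identities and translations -/

/-- `(Q_x ∘ lift) ∘ Θ' = Q^θ_{θ₀x} ∘ lift`. [folklore] -/
theorem curv_shift_lift_negReflect (r : LatticeRep G) (T : ℕ) (x : Site 4) (U : GaugeConfig 4 T G) :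
    r.curvature.F (configShift (-x) (torusLift T U.negReflect)) =
      r.curvature.timeReflect.F (configShift (-(siteReflect x)) (torusLift T U)) := by
  rw [torusLift_negReflect, LocalGaugeObservable.timeReflect_F]
  simp only []
  rw [cfgReflect_configShift, siteReflect_neg, siteReflect_siteReflect]

/-- `(Q^θ_x ∘ lift) ∘ Θ' = Q_{θ₀x} ∘ lift`. [folklore] -/
theorem curvθ_shift_lift_negReflect (r : LatticeRep G) (T : ℕ) (x : Site 4) (U : GaugeConfig 4 T G) :
    r.curvature.timeReflect.F (configShift (-x) (torusLift T U.negReflect)) =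
      r.curvature.F (configShift (-(siteReflect x)) (torusLift T U)) := by
  rw [torusLift_negReflect, LocalGaugeObservable.timeReflect_F]
  simp only []
  rw [cfgReflect_configShift, siteReflect_neg, cfgReflect_cfgReflect]

/-- Translation invariance of one-point integrals in lifted form. [folklore] -/
theorem integral_shift_lift {N : ℕ} (ρ : G →* Matrix (Fin N) (Fin N) ℂ) (β : ℝ) (T : ℕ) [NeZero T]
    (A : LGConfig 4 G → ℝ) (x : Site 4) :
    ∫ U, A (configShift (-x) (torusLift T U)) ∂(wilsonMeasure ρ β : Measure (GaugeConfig 4 T G)) =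
      ∫ U, A (torusLift T U) ∂(wilsonMeasure ρ β : Measure (GaugeConfig 4 T G)) :=
  integral_comp_configShift_torusLift (d := 4) (S := T) ρ β A (-x)

/-- Translation invariance of two-point integrals in lifted form: only the separation matters. [folklore] -/
theorem integral_mul_shift_lift {N : ℕ} (ρ : G →* Matrix (Fin N) (Fin N) ℂ) (β : ℝ) (T : ℕ) [NeZero T]
    (A B : LGConfig 4 G → ℝ) (x y : Site 4) :
    ∫ U, A (configShift (-x) (torusLift T U)) * B (configShift (-y) (torusLift T U))
        ∂(wilsonMeasure ρ β : Measure (GaugeConfig 4 T G)) =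
      ∫ U, A (torusLift T U) * B (configShift (-(y - x)) (torusLift T U))
        ∂(wilsonMeasure ρ β : Measure (GaugeConfig 4 T G)) := by
  have h := integral_comp_configShift_torusLift (d := 4) (S := T) ρ β
    (fun V => A (configShift (-x) V) * B (configShift (-y) V)) x
  simp only [LatticeWindow.configShift_configShift, neg_add_cancel, LatticeWindow.configShift_zero] at h
  rw [← h, show -(y - x) = -y + x by abel]

end AxisDom

open AxisDom in
/-- **Stub A · `AxisDominationOfForm`** (registered stub of stmt-QuantumFields-11687, skeleton v13 of line
`sixteen-charts-analytic-kernel`): THE TIME AXIS IS EXTREMAL. From the odd-torus site-RP form F: for `β ≥ 0`, `z 0 = n`, `3 ≤ n ≤ L`,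
`Cov(Q_0,Q_z)² ≤ lCC(Q,Q^θ,2⌈n/2⌉) · lCC(Q^θ,Q,2⌊n/2⌋)` with both axis covariances non-negative. [OsterwalderSeiler1978 §2; folklore] -/
theorem AxisDominationOfForm : (open Literature.MathematicalPhysics.QuantumLattice Literature.MathematicalPhysics.AQFT Literature.MathematicalPhysics.QuantumFieldTheory in ∀ (G : Type) [Group G] [TopologicalSpace G] [IsTopologicalGroup G] [CompactSpace G] [MeasurableSpace G] [BorelSpace G] (N : ℕ) (ρ : G →* Matrix (Fin N) (Fin N) ℂ), Continuous ρ → ∀ (β : ℝ), 0 ≤ β → ∀ (S : ℕ), 1 ≤ S → ∀ (F H : GaugeConfig 4 (2 * S + 1) G → ℝ), Measurable F → Measurable H → (∃ C : ℝ, ∀ U, |F U| ≤ C) → (∃ C : ℝ, ∀ U, |H U| ≤ C) → DependsOn F {e : Edge 4 (2 * S + 1) | (e.1 0).val ≤ S ∧ (e.2 = 0 → (e.1 0).val < S)} → DependsOn H {e : Edge 4 (2 * S + 1) | (e.1 0).val ≤ S ∧ (e.2 = 0 → (e.1 0).val < S)} → 0 ≤ ((∫ U, F U.negReflect * F U ∂(wilsonMeasure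 ρ β : MeasureTheory.Measure (GaugeConfig 4 (2 * S + 1) G))) - (∫ U, F U ∂(wilsonMeasure ρ β : MeasureTheory.Measure (GaugeConfig 4 (2 * S + 1) G))) * (∫ U, F U ∂(wilsonMeasure ρ β : MeasureTheory.Measure (GaugeConfig 4 (2 * S + 1) G)))) ∧ 0 ≤ ((∫ U, H U.negReflect * H U ∂(wilsonMeasure ρ β : MeasureTheory.Measure (GaugeConfig 4 (2 * S + 1) G))) - (∫ U, H U ∂(wilsonMeasure ρ β : MeasureTheory.Measure (GaugeConfig 4 (2 * S + 1) G))) * (∫ U, H U ∂(wilsonMeasure ρ β : MeasureTheory.Measure (GaugeConfig 4 (2 * S + 1) G)))) ∧ ((∫ U, F U.negReflect * H U ∂(wilsonMeasure ρ β : MeasureTheory.Measure (GaugeConfig 4 (2 * S + 1) G))) - (∫ U, F U ∂(wilsonMeasure ρ β : MeasureTheory.Measure (GaugeConfig 4 (2 * S + 1) G))) * (∫ U, H U ∂(wilsonMeasure ρ β : MeasureTheory.Measure (GaugeConfig 4 (2 * S + 1) G)))) ^ 2 ≤ ((∫ U, F U.negReflect * F U ∂(wilsonMeasure ρ β : MeasureTheory.Measure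 (GaugeConfig 4 (2 * S + 1) G))) - (∫ U, F U ∂(wilsonMeasure ρ β : MeasureTheory.Measure (GaugeConfig 4 (2 * S + 1) G))) * (∫ U, F U ∂(wilsonMeasure ρ β : MeasureTheory.Measure (GaugeConfig 4 (2 * S + 1) G)))) * ((∫ U, H U.negReflect * H U ∂(wilsonMeasure ρ β : MeasureTheory.Measure (GaugeConfig 4 (2 * S + 1) G))) - (∫ U, H U ∂(wilsonMeasure ρ β : MeasureTheory.Measure (GaugeConfig 4 (2 * S + 1) G))) * (∫ U, H U ∂(wilsonMeasure ρ β : MeasureTheory.Measure (GaugeConfig 4 (2 * S + 1) G))))) → open Literature.MathematicalPhysics.QuantumLattice Literature.MathematicalPhysics.AQFT Literature.MathematicalPhysics.QuantumFieldTheory in ∀ (G : Type) [Group G] [TopologicalSpace G] [IsTopologicalGroup G] [CompactSpace G] [MeasurableSpace G] [BorelSpace G] (r : LatticeRep G) (β : ℝ), 0 ≤ β → ∀ (L : ℕ) (z : Literature.Probability.LatticeModels.Site 4) (n : ℕ), z 0 = n → 3 ≤ n → n ≤ L → 0 ≤ latticeConnectedCorr r.ρ β (2 * L + 1) r.curvature.timeReflect.F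 r.curvature.F (2 * (n / 2)) ∧ 0 ≤ latticeConnectedCorr r.ρ β (2 * L + 1) r.curvature.F r.curvature.timeReflect.F (2 * ((n + 1) / 2)) ∧ ((∫ U, r.curvature.F (torusLift (2 * L + 1) U) * r.curvature.F (configShift (-z) (torusLift (2 * L + 1) U)) ∂(wilsonMeasure r.ρ β : MeasureTheory.Measure (GaugeConfig 4 (2 * L + 1) G))) - (∫ U, r.curvature.F (torusLift (2 * L + 1) U) ∂(wilsonMeasure r.ρ β : MeasureTheory.Measure (GaugeConfig 4 (2 * L + 1) G))) * (∫ U, r.curvature.F (configShift (-z) (torusLift (2 * L + 1) U)) ∂(wilsonMeasure r.ρ β : MeasureTheory.Measure (GaugeConfig 4 (2 * L + 1) G)))) ^ 2 ≤ latticeConnectedCorr r.ρ β (2 * L + 1) r.curvature.F r.curvature.timeReflect.F (2 * ((n + 1) / 2)) * latticeConnectedCorr r.ρ β (2 * L + 1) r.curvature.timeReflect.F r.curvature.F (2 * (n / 2)) := by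
  intro hF G _ _ _ _ _ _ r β hβ L z n hz0 hn3 hnL
  -- the two heights `t = ⌊n/2⌋`, `t' = ⌈n/2⌉`
  have htt' : n / 2 + (n + 1) / 2 = n := by omega
  have ht'2 : 2 ≤ (n + 1) / 2 := by omega
  have ht'L : (n + 1) / 2 ≤ L := by omega
  have htL : n / 2 + 2 ≤ L := by omega
  have hL1 : 1 ≤ L := by omega
  -- the base points `w = t' e₀` (for `Q^θ`), `u = −t' e₀ = θ₀ w`, `v = z + u` (for `Q`; `v⁰ = t`)
  obtain ⟨w, hw⟩ : ∃ w : Literature.Probability.LatticeModels.Site 4, w = Pi.single 0 ((((n + 1) / 2 : ℕ)) : ℤ) := ⟨_, rfl⟩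
  obtain ⟨u, hu⟩ : ∃ u : Literature.Probability.LatticeModels.Site 4, u = -Pi.single 0 ((((n + 1) / 2 : ℕ)) : ℤ) := ⟨_, rfl⟩
  obtain ⟨v, hv⟩ : ∃ v : Literature.Probability.LatticeModels.Site 4, v = z + u := ⟨_, rfl⟩
  have hθw : siteReflect w = u := by
    rw [hw, hu]; funext k; rw [siteReflect_apply_ite]
    by_cases hk : k = 0
    · subst hk; simp
    · simp [hk]
  have hw0 : w 0 = (((n + 1) / 2 : ℕ) : ℤ) := by simp [hw]
  have hv0 : v 0 = ((n / 2 : ℕ) : ℤ) := by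
    simp only [hv, hu, Pi.add_apply, Pi.neg_apply, Pi.single_eq_same, hz0]
    omega
  have hwu : w - u = Pi.single 0 (((2 * ((n + 1) / 2) : ℕ)) : ℤ) := by
    funext k
    by_cases hk : k = 0
    · subst hk; simp [hw, hu]; ring
    · simp [hw, hu, hk]
  have hvθ : v - siteReflect v = Pi.single 0 (((2 * (n / 2) : ℕ)) : ℤ) := by
    rw [sub_siteReflect_eq_single, hv0]; push_cast; ring_nf
  have hvu : v - u = z := by rw [hv]; abel
  -- the two observables
  obtain ⟨F₀, hF₀⟩ : ∃ F₀ : GaugeConfig 4 (2 * L + 1) G → ℝ,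
      F₀ = fun U => r.curvature.timeReflect.F (configShift (-w) (torusLift (2 * L + 1) U)) := ⟨_, rfl⟩
  obtain ⟨G₀, hG₀⟩ : ∃ G₀ : GaugeConfig 4 (2 * L + 1) G → ℝ,
      G₀ = fun U => r.curvature.F (configShift (-v) (torusLift (2 * L + 1) U)) := ⟨_, rfl⟩
  have hlift : Measurable (torusLift (d := 4) (G := G) (2 * L + 1)) := measurable_torusLift _
  have hF₀m : Measurable F₀ := by
    rw [hF₀]; exact r.curvature.timeReflect.measurable.comp ((configShift (-w)).measurable.comp hlift)
  have hG₀m : Measurable G₀ := by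
    rw [hG₀]; exact r.curvature.measurable.comp ((configShift (-v)).measurable.comp hlift)
  have hF₀b : ∃ C : ℝ, ∀ U, |F₀ U| ≤ C := by
    rw [hF₀]; exact r.curvature.timeReflect.bounded.imp fun C hC U => hC _
  have hG₀b : ∃ C : ℝ, ∀ U, |G₀ U| ≤ C := by
    rw [hG₀]; exact r.curvature.bounded.imp fun C hC U => hC _
  have hF₀d : DependsOn F₀ {e : Edge 4 (2 * L + 1) | (e.1 0).val ≤ L ∧ (e.2 = 0 → (e.1 0).val < L)} := by
    rw [hF₀]; exact dependsOn_curvθ_posHalf r w hw0 ht'2 ht'L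
  have hG₀d : DependsOn G₀ {e : Edge 4 (2 * L + 1) | (e.1 0).val ≤ L ∧ (e.2 = 0 → (e.1 0).val < L)} := by
    rw [hG₀]; exact dependsOn_curv_posHalf r v hv0 htL
  obtain ⟨h1, h2, h3⟩ := hF G r.N r.ρ r.continuous β hβ L hL1 F₀ G₀ hF₀m hG₀m hF₀b hG₀b hF₀d hG₀d
  -- reflection identities
  have eF : ∀ U : GaugeConfig 4 (2 * L + 1) G,
      F₀ U.negReflect = r.curvature.F (configShift (-u) (torusLift (2 * L + 1) U)) := by
    intro U; rw [hF₀]; simp only []; rw [curvθ_shift_lift_negReflect, hθw]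
  have eG : ∀ U : GaugeConfig 4 (2 * L + 1) G,
      G₀ U.negReflect = r.curvature.timeReflect.F (configShift (-(siteReflect v)) (torusLift (2 * L + 1) U)) := by
    intro U; rw [hG₀]; simp only []; rw [curv_shift_lift_negReflect]
  have eF' : ∀ U : GaugeConfig 4 (2 * L + 1) G,
      F₀ U = r.curvature.timeReflect.F (configShift (-w) (torusLift (2 * L + 1) U)) := fun U => by rw [hF₀]
  have eG' : ∀ U : GaugeConfig 4 (2 * L + 1) G,
      G₀ U = r.curvature.F (configShift (-v) (torusLift (2 * L + 1) U)) := fun U => by rw [hG₀]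
  -- means
  have mF' : ∫ U, F₀ U ∂(wilsonMeasure r.ρ β : MeasureTheory.Measure (GaugeConfig 4 (2 * L + 1) G)) =
      ∫ U, r.curvature.timeReflect.F (torusLift (2 * L + 1) U) ∂(wilsonMeasure r.ρ β) := by
    simp_rw [eF']; exact integral_shift_lift r.ρ β _ _ w
  have mF : ∫ U, F₀ U ∂(wilsonMeasure r.ρ β : MeasureTheory.Measure (GaugeConfig 4 (2 * L + 1) G)) =
      ∫ U, r.curvature.F (torusLift (2 * L + 1) U) ∂(wilsonMeasure r.ρ β) := by
    rw [← integral_comp_negReflect_eq r.ρ r.continuous β F₀]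
    simp_rw [eF]; exact integral_shift_lift r.ρ β _ _ u
  have mG : ∫ U, G₀ U ∂(wilsonMeasure r.ρ β : MeasureTheory.Measure (GaugeConfig 4 (2 * L + 1) G)) =
      ∫ U, r.curvature.F (torusLift (2 * L + 1) U) ∂(wilsonMeasure r.ρ β) := by
    simp_rw [eG']; exact integral_shift_lift r.ρ β _ _ v
  have mG' : ∫ U, G₀ U ∂(wilsonMeasure r.ρ β : MeasureTheory.Measure (GaugeConfig 4 (2 * L + 1) G)) =
      ∫ U, r.curvature.timeReflect.F (torusLift (2 * L + 1) U) ∂(wilsonMeasure r.ρ β) := by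
    rw [← integral_comp_negReflect_eq r.ρ r.continuous β G₀]
    simp_rw [eG]; exact integral_shift_lift r.ρ β _ _ (siteReflect v)
  have mz : ∫ U, r.curvature.F (configShift (-z) (torusLift (2 * L + 1) U))
        ∂(wilsonMeasure r.ρ β : MeasureTheory.Measure (GaugeConfig 4 (2 * L + 1) G)) =
      ∫ U, r.curvature.F (torusLift (2 * L + 1) U) ∂(wilsonMeasure r.ρ β) := integral_shift_lift r.ρ β _ _ z
  -- pair integrals
  have pFF : ∫ U, F₀ U.negReflect * F₀ U ∂(wilsonMeasure r.ρ β : MeasureTheory.Measure (GaugeConfig 4 (2 * L + 1) G)) =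
      ∫ U, r.curvature.F (torusLift (2 * L + 1) U) * r.curvature.timeReflect.F
        (configShift (-Pi.single 0 (((2 * ((n + 1) / 2) : ℕ)) : ℤ)) (torusLift (2 * L + 1) U)) ∂(wilsonMeasure r.ρ β) := by
    simp_rw [eF, eF']; rw [integral_mul_shift_lift, hwu]
  have pGG : ∫ U, G₀ U.negReflect * G₀ U ∂(wilsonMeasure r.ρ β : MeasureTheory.Measure (GaugeConfig 4 (2 * L + 1) G)) =
      ∫ U, r.curvature.timeReflect.F (torusLift (2 * L + 1) U) * r.curvature.F
        (configShift (-Pi.single 0 (((2 * (n / 2) : ℕ)) : ℤ)) (torusLift (2 * L + 1) U)) ∂(wilsonMeasure r.ρ β) := by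
    simp_rw [eG, eG']; rw [integral_mul_shift_lift, hvθ]
  have pFG : ∫ U, F₀ U.negReflect * G₀ U ∂(wilsonMeasure r.ρ β : MeasureTheory.Measure (GaugeConfig 4 (2 * L + 1) G)) =
      ∫ U, r.curvature.F (torusLift (2 * L + 1) U) * r.curvature.F (configShift (-z) (torusLift (2 * L + 1) U))
        ∂(wilsonMeasure r.ρ β) := by
    simp_rw [eF, eG']; rw [integral_mul_shift_lift, hvu]
  -- products of means
  have prFF : (∫ U, F₀ U ∂(wilsonMeasure r.ρ β : MeasureTheory.Measure (GaugeConfig 4 (2 * L + 1) G))) *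
      (∫ U, F₀ U ∂(wilsonMeasure r.ρ β : MeasureTheory.Measure (GaugeConfig 4 (2 * L + 1) G))) =
      (∫ U, r.curvature.F (torusLift (2 * L + 1) U) ∂(wilsonMeasure r.ρ β)) *
      (∫ U, r.curvature.timeReflect.F (torusLift (2 * L + 1) U) ∂(wilsonMeasure r.ρ β)) := by
    nth_rewrite 1 [mF]; rw [mF']
  have prGG : (∫ U, G₀ U ∂(wilsonMeasure r.ρ β : MeasureTheory.Measure (GaugeConfig 4 (2 * L + 1) G))) *
      (∫ U, G₀ U ∂(wilsonMeasure r.ρ β : MeasureTheory.Measure (GaugeConfig 4 (2 * L + 1) G))) =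
      (∫ U, r.curvature.timeReflect.F (torusLift (2 * L + 1) U) ∂(wilsonMeasure r.ρ β)) *
      (∫ U, r.curvature.F (torusLift (2 * L + 1) U) ∂(wilsonMeasure r.ρ β)) := by
    nth_rewrite 1 [mG']; rw [mG]
  have prFG : (∫ U, F₀ U ∂(wilsonMeasure r.ρ β : MeasureTheory.Measure (GaugeConfig 4 (2 * L + 1) G))) *
      (∫ U, G₀ U ∂(wilsonMeasure r.ρ β : MeasureTheory.Measure (GaugeConfig 4 (2 * L + 1) G))) =
      (∫ U, r.curvature.F (torusLift (2 * L + 1) U) ∂(wilsonMeasure r.ρ β)) *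
      (∫ U, r.curvature.F (configShift (-z) (torusLift (2 * L + 1) U)) ∂(wilsonMeasure r.ρ β)) := by
    rw [mF, mG, mz]
  rw [pFF, prFF] at h1
  rw [pGG, prGG] at h2
  rw [pFG, prFG, pFF, prFF, pGG, prGG] at h3
  unfold latticeConnectedCorr
  exact ⟨h2, h1, h3⟩

end Summit.QuantumFields.YangMills.Theorems.CurvatureKernel

end
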